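import Summits.AtomisticToContinuum.HydrodynamicLimit.Theorems.InformationPercolationEngineChaosClosesEulerPressureValueA
import HarnessLib

/-!
# Collisional pressure value in band (crux `ChaosClosesEuler`, stmt-AtomisticToContinuum-15141, line `Sketch`,
# stub `stub_pressureValueOfEnskog`) — helper B: the pair functional of the truncated stress mark

WHAT. For ONE configuration `w` of `N + 1` particles, one centre `x` and the cone scale `r`, with the weights
`cᵢ = b_r(xᵢ, x) ψ_L(‖vᵢ‖)` (cone kernel times speed cutoff) and the truncated single-law moments
`S₀ = Σ cᵢ`, `S₁ₘ = Σ cᵢ vᵢₘ`, `S₂ₘₙ = Σ cᵢ vᵢₘ vᵢₙ`: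

* `pairFunctional_markT_eq` — the `r`-mollified pair functional of the truncated stress mark `𝒯[L,k,l]` of helper A
  is the finite combination of PRODUCTS of single-law moments
  `B_r(𝒯) = (4π/15)(N+1)⁻² (δ_kl Σₘ Qₘₘ + 2 Q_kl)`, `Qₘₙ = S₀ S₂ₘₙ − S₁ₘ S₁ₙ` (Enskog tensor identity of helper A and
  the weighted double-sum identity `Σᵢⱼ cᵢcⱼ (pⱼ − pᵢ)(qⱼ − qᵢ) = 2(S₀ Σcpq − Σcp Σcq)`);
* `trQ_nonneg`, `trQ_le`, `abs_Q_le_trQ`, `abs_pairFunctional_markT_le` — `Q` is a Gram form: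
  `0 ≤ (N+1)⁻² tr Q ≤ 2ρ_r e_r − ‖m_r‖² = 3ρ_r²θ_r` (the cutoff only removes weight) and `|Q_kl| ≤ tr Q`, whence the
  a-priori bound `|B_r(𝒯)| ≤ (12π/5) ρ_r² θ_r` used off the bulk;
* `pairFunctional_markB_mem` — `0 ≤ B_r(ℬ[L]) ≤ 16πL² ρ_r²` for the dominating mark;
* `two_mul_pexC_eq` — the equation-of-state VALUE identity `σ³ Y(σ³ρ) (4π/3) ρ²θ = 2 (hsPressure σ ρ θ − ρθ)` with
  `Y = contactValue = (3/2π) f_ex′` (a `ring` identity, no analyticity needed).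

References: S. Chapman, T. G. Cowling (1970) §16.4; H. van Beijeren, M. H. Ernst, Physica 68 (1973) 437.
-/

noncomputable section

namespace Summit.AtomisticToContinuum.HydrodynamicLimit.Theorems.ChaosClosesEulerPressureValue

open scoped BigOperators Topology Classical MeasureTheory ENNReal InnerProductSpace
open Filter Set MeasureTheory
open Literature.MathematicalPhysics.KineticTheory
open Literature.Analysis.FluidPDE
open Summit.AtomisticToContinuum.HydrodynamicLimit.Theorems.LocalSecondLawNegative
open Summit.AtomisticToContinuum.HydrodynamicLimit.Theorems.LocalSecondLawLedger
open Summit.AtomisticToContinuum.HydrodynamicLimit.Theorems.LocalSecondLawLedger.L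
  (Mmom rhoC_eq_sum momC_apply_eq_sum momC_eq_sum kinC_eq_trace norm_sq_eq_sum)

/-- The truncated stress mark `𝒯[L,k,l]` (local notation for an explicit lambda). -/
local notation3 "𝒯[" L ", " k ", " l "]" => fun q : V3 × V3 × V3 =>
  min |⟪q.2.1 - q.2.2, q.1⟫_ℝ| (4 * L) * (speedCutoff L ‖q.2.1‖ * speedCutoff L ‖q.2.2‖) * (clip1 (q.1 k) * clip1 (q.1 l))

/-- The dominating mark `ℬ[L]` (local notation for an explicit lambda). -/
local notation3 "ℬ[" L "]" => fun q : V3 × V3 × V3 => 4 * L * (speedCutoff L ‖q.2.1‖ * speedCutoff L ‖q.2.2‖)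

variable {N : ℕ}

/-! ## §1 Weighted double sums -/

/-- `Σᵢ Σⱼ cᵢ cⱼ (pⱼ − pᵢ)(qⱼ − qᵢ) = 2 (S₀ Σ cᵢpᵢqᵢ − (Σ cᵢpᵢ)(Σ cᵢqᵢ))`. [folklore] -/
theorem sum_sum_mul_sub_mul_sub {n : ℕ} (c p q : Fin n → ℝ) :
    ∑ i, ∑ j, c i * c j * ((p j - p i) * (q j - q i)) =
      2 * ((∑ i, c i) * (∑ i, c i * (p i * q i)) - (∑ i, c i * p i) * (∑ i, c i * q i)) := by
  have hA : ∑ i, ∑ j, c i * (c j * (p j * q j)) = (∑ i, c i) * ∑ j, c j * (p j * q j) := by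
    rw [Finset.sum_mul_sum]
  have hA' : ∑ i, ∑ j, c i * (p i * q i) * c j = (∑ i, c i) * ∑ j, c j * (p j * q j) := by
    rw [Finset.sum_comm, Finset.sum_mul_sum]
    exact Finset.sum_congr rfl fun i _ => Finset.sum_congr rfl fun j _ => by ring
  have hB : ∑ i, ∑ j, c i * p i * (c j * q j) = (∑ i, c i * p i) * ∑ j, c j * q j := by
    rw [Finset.sum_mul_sum]
  have hB' : ∑ i, ∑ j, c i * q i * (c j * p j) = (∑ i, c i * p i) * ∑ j, c j * q j := by
    rw [mul_comm, Finset.sum_mul_sum]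
  calc ∑ i, ∑ j, c i * c j * ((p j - p i) * (q j - q i))
      = ∑ i, ∑ j, (c i * (c j * (p j * q j)) + c i * (p i * q i) * c j
          - c i * p i * (c j * q j) - c i * q i * (c j * p j)) :=
        Finset.sum_congr rfl fun i _ => Finset.sum_congr rfl fun j _ => by ring
    _ = ∑ i, ∑ j, c i * (c j * (p j * q j)) + ∑ i, ∑ j, c i * (p i * q i) * c j
          - ∑ i, ∑ j, c i * p i * (c j * q j) - ∑ i, ∑ j, c i * q i * (c j * p j) := by
        simp only [Finset.sum_add_distrib, Finset.sum_sub_distrib]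
    _ = _ := by rw [hA, hA', hB, hB']; ring

/-- Coordinates of a weighted sum of vectors. [folklore] -/
theorem sum_smul_apply {n : ℕ} (c : Fin n → ℝ) (v : Fin n → V3) (m : Fin 3) :
    (∑ i, c i • v i) m = ∑ i, c i * v i m := by
  simp [Finset.sum_apply]

/-- `(Σ cᵢ)(Σ cᵢ‖vᵢ‖²) = Σₘ (Σ cᵢ)(Σ cᵢ vᵢₘ²)`. [folklore] -/
theorem sum_mul_sum_norm_sq {n : ℕ} (c : Fin n → ℝ) (v : Fin n → V3) :
    (∑ i, c i) * (∑ i, c i * ‖v i‖ ^ 2) = ∑ m : Fin 3, (∑ i, c i) * (∑ i, c i * (v i m * v i m)) := by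
  rw [← Finset.mul_sum]
  congr 1
  rw [Finset.sum_comm]
  refine Finset.sum_congr rfl fun i _ => ?_
  rw [← Finset.mul_sum, norm_sq_eq_sum]
  exact congrArg _ (Finset.sum_congr rfl fun m _ => sq _)

/-- `‖Σ cᵢvᵢ‖² = Σₘ (Σ cᵢvᵢₘ)(Σ cᵢvᵢₘ)`. [folklore] -/
theorem norm_sum_smul_sq {n : ℕ} (c : Fin n → ℝ) (v : Fin n → V3) :
    ‖∑ i, c i • v i‖ ^ 2 = ∑ m : Fin 3, (∑ i, c i * v i m) * (∑ i, c i * v i m) := by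
  rw [norm_sq_eq_sum]
  exact Finset.sum_congr rfl fun m _ => by rw [sum_smul_apply, sq]

/-- `Σᵢ Σⱼ cᵢ cⱼ ‖vⱼ − vᵢ‖² = 2 (S₀ Σ cᵢ‖vᵢ‖² − ‖Σ cᵢvᵢ‖²)`. [folklore] -/
theorem sum_sum_mul_norm_sub_sq {n : ℕ} (c : Fin n → ℝ) (v : Fin n → V3) :
    ∑ i, ∑ j, c i * c j * ‖v j - v i‖ ^ 2 =
      2 * ((∑ i, c i) * (∑ i, c i * ‖v i‖ ^ 2) - ‖∑ i, c i • v i‖ ^ 2) := by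
  have h1 : ∀ i j, c i * c j * ‖v j - v i‖ ^ 2 = ∑ m : Fin 3, c i * c j * ((v j m - v i m) * (v j m - v i m)) := by
    intro i j
    rw [norm_sq_eq_sum, Finset.mul_sum]
    exact Finset.sum_congr rfl fun m _ => by rw [PiLp.sub_apply, sq]
  simp_rw [h1]
  rw [Finset.sum_congr rfl fun i _ => Finset.sum_comm, Finset.sum_comm]
  simp_rw [sum_sum_mul_sub_mul_sub]
  rw [sum_mul_sum_norm_sq, norm_sum_smul_sq, ← Finset.sum_sub_distrib, Finset.mul_sum]

/-- **The Gram trace is half the weighted double sum of squared velocity differences**: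
`Σₘ (S₀S₂ₘₘ − S₁ₘ²) = ½ Σᵢⱼ cᵢcⱼ ‖vⱼ − vᵢ‖²`. [folklore] -/
theorem trQ_eq_half {n : ℕ} (c : Fin n → ℝ) (v : Fin n → V3) :
    ∑ m : Fin 3, ((∑ i, c i) * (∑ i, c i * (v i m * v i m)) - (∑ i, c i * v i m) * (∑ i, c i * v i m)) =
      (∑ i, ∑ j, c i * c j * ‖v j - v i‖ ^ 2) / 2 := by
  rw [sum_sum_mul_norm_sub_sq, sum_mul_sum_norm_sq, norm_sum_smul_sq, ← Finset.sum_sub_distrib]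
  ring

/-! ## §2 The pair functional of the truncated stress mark -/

/-- The cone kernel of the Literature vocabulary is the crux's `cone` (definitional). [folklore] -/
theorem coneKernel_eq_cone (r : ℝ) (y x : T3) : coneKernel r y x = cone r y x := rfl

/-- **`B_r(𝒯[L,k,l])` as a combination of products of truncated single-law moments**:
`(4π/15)(N+1)⁻² (δ_kl Σₘ (S₀S₂ₘₘ − S₁ₘ²) + 2 (S₀S₂ₖₗ − S₁ₖS₁ₗ))` with `cᵢ = b_r(xᵢ,x) ψ_L(‖vᵢ‖)`.
[cite: ChapmanCowling1970, §16.4] -/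
theorem pairFunctional_markT_eq {L : ℝ} (hL : 0 < L) (r : ℝ) (w : Phase N) (x : T3) (k l : Fin 3) :
    pairFunctional r 𝒯[L, k, l] w x = 4 * Real.pi / 15 * (((N + 1 : ℕ) : ℝ)⁻¹ * ((N + 1 : ℕ) : ℝ)⁻¹) *
      ((if k = l then 1 else 0) * ∑ m : Fin 3,
          ((∑ i, cone r (w i).1 x * speedCutoff L ‖(w i).2‖) *
              (∑ i, cone r (w i).1 x * speedCutoff L ‖(w i).2‖ * ((w i).2 m * (w i).2 m)) -
            (∑ i, cone r (w i).1 x * speedCutoff L ‖(w i).2‖ * (w i).2 m) *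
              (∑ i, cone r (w i).1 x * speedCutoff L ‖(w i).2‖ * (w i).2 m)) +
        2 * ((∑ i, cone r (w i).1 x * speedCutoff L ‖(w i).2‖) *
              (∑ i, cone r (w i).1 x * speedCutoff L ‖(w i).2‖ * ((w i).2 k * (w i).2 l)) -
            (∑ i, cone r (w i).1 x * speedCutoff L ‖(w i).2‖ * (w i).2 k) *
              (∑ i, cone r (w i).1 x * speedCutoff L ‖(w i).2‖ * (w i).2 l))) := by
  rw [pairFunctional_eq_double_sum]
  simp only [coneKernel_eq_cone, sphereMark_markT hL]
  set c : Fin (N + 1) → ℝ := fun i => cone r (w i).1 x * speedCutoff L ‖(w i).2‖ with hc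
  have hterm : ∀ i j, cone r (w i).1 x * cone r (w j).1 x * (speedCutoff L ‖(w i).2‖ * speedCutoff L ‖(w j).2‖ *
      (2 * Real.pi / 15 * (‖(w j).2 - (w i).2‖ ^ 2 * (if k = l then 1 else 0) +
        2 * (((w j).2 - (w i).2) k * ((w j).2 - (w i).2) l)))) =
      2 * Real.pi / 15 * ((if k = l then 1 else 0) * (c i * c j * ‖(w j).2 - (w i).2‖ ^ 2) +
        2 * (c i * c j * (((w j).2 k - (w i).2 k) * ((w j).2 l - (w i).2 l)))) := by
    intro i j
    simp only [hc, PiLp.sub_apply]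
    ring
  simp_rw [hterm]
  simp_rw [← Finset.mul_sum, Finset.sum_add_distrib, ← Finset.mul_sum]
  rw [sum_sum_mul_norm_sub_sq c (fun i => (w i).2),
    sum_sum_mul_sub_mul_sub c (fun i => (w i).2 k) (fun i => (w i).2 l),
    sum_mul_sum_norm_sq, norm_sum_smul_sq, ← Finset.sum_sub_distrib]
  simp only [hc]
  ring

/-! ## §3 The Gram form: positivity and the a-priori bound -/

/-- `2 ρ_r e_r − ‖m_r‖² = 3 ρ_r² θ_r` (definition of `θ_r`; both sides vanish on the empty cone). [folklore] -/
theorem two_mul_rhoC_mul_kinC_sub (r : ℝ) (hr : 0 < r) (w : Phase N) (x : T3) :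
    2 * rhoC r w x * kinC r w x - ‖momC r w x‖ ^ 2 = 3 * (rhoC r w x ^ 2 * thetaC r w x) := by
  by_cases h : rhoC r w x = 0
  · rw [ChaosClosesEulerReduction.momC_eq_zero_of_rhoC hr h, h]; simp
  · have h1 := psvK_rhoC_mul_thetaC h
    have h2 : rhoC r w x ^ 2 * thetaC r w x = rhoC r w x * (rhoC r w x * thetaC r w x) := by ring
    rw [h2, h1]
    field_simp

/-- The untruncated Gram trace: `(N+1)⁻² ½ Σᵢⱼ bᵢbⱼ ‖vⱼ − vᵢ‖² = 2ρ_r e_r − ‖m_r‖² = 3ρ_r²θ_r`. [folklore] -/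
theorem sum_sum_cone_mul_norm_sub_sq_eq {r : ℝ} (hr : 0 < r) (w : Phase N) (x : T3) :
    ((N + 1 : ℕ) : ℝ)⁻¹ * ((N + 1 : ℕ) : ℝ)⁻¹ * ∑ i, ∑ j, cone r (w i).1 x * cone r (w j).1 x * ‖(w j).2 - (w i).2‖ ^ 2 =
      2 * (3 * (rhoC r w x ^ 2 * thetaC r w x)) := by
  rw [sum_sum_mul_norm_sub_sq, ← two_mul_rhoC_mul_kinC_sub r hr, rhoC_eq_sum, momC_eq_sum, kinC_eq_sum,
    norm_smul, Real.norm_eq_abs, abs_of_nonneg (by positivity : (0 : ℝ) ≤ ((N + 1 : ℕ) : ℝ)⁻¹)]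
  have h2 : ∑ i, cone r (w i).1 x * (‖(w i).2‖ ^ 2 / 2) = (∑ i, cone r (w i).1 x * ‖(w i).2‖ ^ 2) / 2 := by
    rw [Finset.sum_div]; exact Finset.sum_congr rfl fun i _ => by ring
  rw [h2]
  ring

/-- Termwise domination of the truncated Gram trace by the untruncated one (`cᵢ = bᵢψᵢ ≤ bᵢ`, all `≥ 0`). [folklore] -/
theorem sum_sum_cc_mul_norm_sub_sq_le (L : ℝ) {r : ℝ} (hr : 0 < r) (w : Phase N) (x : T3) :
    ∑ i, ∑ j, cone r (w i).1 x * speedCutoff L ‖(w i).2‖ * (cone r (w j).1 x * speedCutoff L ‖(w j).2‖) *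
        ‖(w j).2 - (w i).2‖ ^ 2 ≤
      ∑ i, ∑ j, cone r (w i).1 x * cone r (w j).1 x * ‖(w j).2 - (w i).2‖ ^ 2 := by
  refine Finset.sum_le_sum fun i _ => Finset.sum_le_sum fun j _ => ?_
  have hi := cone_nonneg hr (w i).1 x
  have hj := cone_nonneg hr (w j).1 x
  have hci := speedCutoff_mem_Icc L ‖(w i).2‖
  have hcj := speedCutoff_mem_Icc L ‖(w j).2‖
  have h1 : cone r (w i).1 x * speedCutoff L ‖(w i).2‖ ≤ cone r (w i).1 x := mul_le_of_le_one_right hi hci.2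
  have h2 : cone r (w j).1 x * speedCutoff L ‖(w j).2‖ ≤ cone r (w j).1 x := mul_le_of_le_one_right hj hcj.2
  refine mul_le_mul_of_nonneg_right ?_ (sq_nonneg _)
  exact mul_le_mul h1 h2 (mul_nonneg hj hcj.1) hi

/-- **The truncated Gram trace is nonnegative and at most `3ρ_r²θ_r`**:
`0 ≤ (N+1)⁻² Σₘ (S₀S₂ₘₘ − S₁ₘ²) ≤ 3ρ_r²θ_r` (`cᵢ = bᵢψ_L(‖vᵢ‖)`). [folklore] -/
theorem trQ_mem {L r : ℝ} (hr : 0 < r) (w : Phase N) (x : T3) :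
    0 ≤ ((N + 1 : ℕ) : ℝ)⁻¹ * ((N + 1 : ℕ) : ℝ)⁻¹ * ∑ m : Fin 3,
        ((∑ i, cone r (w i).1 x * speedCutoff L ‖(w i).2‖) *
            (∑ i, cone r (w i).1 x * speedCutoff L ‖(w i).2‖ * ((w i).2 m * (w i).2 m)) -
          (∑ i, cone r (w i).1 x * speedCutoff L ‖(w i).2‖ * (w i).2 m) *
            (∑ i, cone r (w i).1 x * speedCutoff L ‖(w i).2‖ * (w i).2 m)) ∧
      ((N + 1 : ℕ) : ℝ)⁻¹ * ((N + 1 : ℕ) : ℝ)⁻¹ * ∑ m : Fin 3,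
        ((∑ i, cone r (w i).1 x * speedCutoff L ‖(w i).2‖) *
            (∑ i, cone r (w i).1 x * speedCutoff L ‖(w i).2‖ * ((w i).2 m * (w i).2 m)) -
          (∑ i, cone r (w i).1 x * speedCutoff L ‖(w i).2‖ * (w i).2 m) *
            (∑ i, cone r (w i).1 x * speedCutoff L ‖(w i).2‖ * (w i).2 m)) ≤
        3 * (rhoC r w x ^ 2 * thetaC r w x) := by
  set c : Fin (N + 1) → ℝ := fun i => cone r (w i).1 x * speedCutoff L ‖(w i).2‖ with hc
  have key : ∑ m : Fin 3, ((∑ i, c i) * (∑ i, c i * ((w i).2 m * (w i).2 m)) -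
      (∑ i, c i * (w i).2 m) * (∑ i, c i * (w i).2 m)) = (∑ i, ∑ j, c i * c j * ‖(w j).2 - (w i).2‖ ^ 2) / 2 :=
    trQ_eq_half c (fun i => (w i).2)
  have hnn : 0 ≤ ∑ i, ∑ j, c i * c j * ‖(w j).2 - (w i).2‖ ^ 2 :=
    Finset.sum_nonneg fun i _ => Finset.sum_nonneg fun j _ => mul_nonneg (mul_nonneg
      (mul_nonneg (cone_nonneg hr _ _) (speedCutoff_mem_Icc L _).1)
      (mul_nonneg (cone_nonneg hr _ _) (speedCutoff_mem_Icc L _).1)) (sq_nonneg _)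
  have hN : 0 ≤ ((N + 1 : ℕ) : ℝ)⁻¹ * ((N + 1 : ℕ) : ℝ)⁻¹ := by positivity
  refine ⟨by rw [key]; exact mul_nonneg hN (div_nonneg hnn (by norm_num)), ?_⟩
  rw [key]
  have hle := sum_sum_cc_mul_norm_sub_sq_le L hr w x
  have heq := sum_sum_cone_mul_norm_sub_sq_eq hr w x
  calc ((N + 1 : ℕ) : ℝ)⁻¹ * ((N + 1 : ℕ) : ℝ)⁻¹ * ((∑ i, ∑ j, c i * c j * ‖(w j).2 - (w i).2‖ ^ 2) / 2)
      ≤ ((N + 1 : ℕ) : ℝ)⁻¹ * ((N + 1 : ℕ) : ℝ)⁻¹ *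
          ((∑ i, ∑ j, cone r (w i).1 x * cone r (w j).1 x * ‖(w j).2 - (w i).2‖ ^ 2) / 2) := by
        gcongr
    _ = 3 * (rhoC r w x ^ 2 * thetaC r w x) := by
        rw [mul_div_assoc', heq]; ring

/-- **Off-diagonal Gram entries are dominated by the trace**: `|S₀S₂ₖₗ − S₁ₖS₁ₗ| ≤ Σₘ (S₀S₂ₘₘ − S₁ₘ²)`. [folklore] -/
theorem abs_Q_le_trQ (L r : ℝ) (hr : 0 < r) (w : Phase N) (x : T3) (k l : Fin 3) :
    |(∑ i, cone r (w i).1 x * speedCutoff L ‖(w i).2‖) *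
          (∑ i, cone r (w i).1 x * speedCutoff L ‖(w i).2‖ * ((w i).2 k * (w i).2 l)) -
        (∑ i, cone r (w i).1 x * speedCutoff L ‖(w i).2‖ * (w i).2 k) *
          (∑ i, cone r (w i).1 x * speedCutoff L ‖(w i).2‖ * (w i).2 l)| ≤
      ∑ m : Fin 3, ((∑ i, cone r (w i).1 x * speedCutoff L ‖(w i).2‖) *
          (∑ i, cone r (w i).1 x * speedCutoff L ‖(w i).2‖ * ((w i).2 m * (w i).2 m)) -
        (∑ i, cone r (w i).1 x * speedCutoff L ‖(w i).2‖ * (w i).2 m) *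
          (∑ i, cone r (w i).1 x * speedCutoff L ‖(w i).2‖ * (w i).2 m)) := by
  set c : Fin (N + 1) → ℝ := fun i => cone r (w i).1 x * speedCutoff L ‖(w i).2‖ with hc
  have hc0 : ∀ i, 0 ≤ c i := fun i => mul_nonneg (cone_nonneg hr _ _) (speedCutoff_mem_Icc L _).1
  have hkl : (∑ i, c i) * (∑ i, c i * ((w i).2 k * (w i).2 l)) - (∑ i, c i * (w i).2 k) * (∑ i, c i * (w i).2 l) =
      (∑ i, ∑ j, c i * c j * (((w j).2 k - (w i).2 k) * ((w j).2 l - (w i).2 l))) / 2 := by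
    rw [sum_sum_mul_sub_mul_sub]; ring
  have htr : ∑ m : Fin 3, ((∑ i, c i) * (∑ i, c i * ((w i).2 m * (w i).2 m)) -
      (∑ i, c i * (w i).2 m) * (∑ i, c i * (w i).2 m)) = (∑ i, ∑ j, c i * c j * ‖(w j).2 - (w i).2‖ ^ 2) / 2 :=
    trQ_eq_half c (fun i => (w i).2)
  rw [hkl, htr, abs_div, abs_two]
  refine div_le_div_of_nonneg_right ((Finset.abs_sum_le_sum_abs _ _).trans (Finset.sum_le_sum fun i _ =>
    (Finset.abs_sum_le_sum_abs _ _).trans (Finset.sum_le_sum fun j _ => ?_))) (by norm_num)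
  rw [abs_mul, abs_of_nonneg (mul_nonneg (hc0 i) (hc0 j))]
  refine mul_le_mul_of_nonneg_left ?_ (mul_nonneg (hc0 i) (hc0 j))
  have ha : |(w j).2 k - (w i).2 k| ≤ ‖(w j).2 - (w i).2‖ := by
    have := PiLp.norm_apply_le ((w j).2 - (w i).2) k
    rwa [Real.norm_eq_abs, PiLp.sub_apply] at this
  have hb : |(w j).2 l - (w i).2 l| ≤ ‖(w j).2 - (w i).2‖ := by
    have := PiLp.norm_apply_le ((w j).2 - (w i).2) l
    rwa [Real.norm_eq_abs, PiLp.sub_apply] at this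
  rw [abs_mul, sq]
  exact mul_le_mul ha hb (abs_nonneg _) (norm_nonneg _)

/-- **A-priori bound of the truncated-stress pair functional**: `|B_r(𝒯[L,k,l])| ≤ (12π/5) ρ_r² θ_r`
(`0 < L`, `0 < r`). [folklore] -/
theorem abs_pairFunctional_markT_le {L r : ℝ} (hL : 0 < L) (hr : 0 < r) (w : Phase N) (x : T3) (k l : Fin 3) :
    |pairFunctional r 𝒯[L, k, l] w x| ≤ 12 * Real.pi / 5 * (rhoC r w x ^ 2 * thetaC r w x) := by
  rw [pairFunctional_markT_eq hL]
  have hT := trQ_mem (L := L) hr w x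
  have hQ := abs_Q_le_trQ L r hr w x k l
  set n2 := ((N + 1 : ℕ) : ℝ)⁻¹ * ((N + 1 : ℕ) : ℝ)⁻¹ with hn2
  have hn2' : 0 ≤ n2 := by positivity
  set T := ∑ m : Fin 3, ((∑ i, cone r (w i).1 x * speedCutoff L ‖(w i).2‖) *
      (∑ i, cone r (w i).1 x * speedCutoff L ‖(w i).2‖ * ((w i).2 m * (w i).2 m)) -
    (∑ i, cone r (w i).1 x * speedCutoff L ‖(w i).2‖ * (w i).2 m) *
      (∑ i, cone r (w i).1 x * speedCutoff L ‖(w i).2‖ * (w i).2 m)) with hTdef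
  set Qkl := (∑ i, cone r (w i).1 x * speedCutoff L ‖(w i).2‖) *
      (∑ i, cone r (w i).1 x * speedCutoff L ‖(w i).2‖ * ((w i).2 k * (w i).2 l)) -
    (∑ i, cone r (w i).1 x * speedCutoff L ‖(w i).2‖ * (w i).2 k) *
      (∑ i, cone r (w i).1 x * speedCutoff L ‖(w i).2‖ * (w i).2 l) with hQdef
  have hT0 : 0 ≤ T := by
    rw [hTdef, trQ_eq_half]
    exact div_nonneg (Finset.sum_nonneg fun i _ => Finset.sum_nonneg fun j _ => mul_nonneg (mul_nonneg
      (mul_nonneg (cone_nonneg hr _ _) (speedCutoff_mem_Icc L _).1)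
      (mul_nonneg (cone_nonneg hr _ _) (speedCutoff_mem_Icc L _).1)) (sq_nonneg _)) (by norm_num)
  have h1 : |(if k = l then (1 : ℝ) else 0) * T + 2 * Qkl| ≤ 3 * T := by
    refine (abs_add_le _ _).trans ?_
    have hδ : |(if k = l then (1 : ℝ) else 0) * T| ≤ T := by
      split_ifs
      · rw [one_mul, abs_of_nonneg hT0]
      · rw [zero_mul, abs_zero]; exact hT0
    rw [abs_mul (2 : ℝ), abs_two]
    linarith
  rw [abs_mul, abs_mul, abs_of_nonneg (by positivity : (0 : ℝ) ≤ 4 * Real.pi / 15), abs_of_nonneg hn2']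
  calc 4 * Real.pi / 15 * n2 * |(if k = l then (1 : ℝ) else 0) * T + 2 * Qkl|
      ≤ 4 * Real.pi / 15 * n2 * (3 * T) := by gcongr
    _ = 4 * Real.pi / 5 * (n2 * T) := by ring
    _ ≤ 4 * Real.pi / 5 * (3 * (rhoC r w x ^ 2 * thetaC r w x)) :=
        mul_le_mul_of_nonneg_left hT.2 (by positivity)
    _ = 12 * Real.pi / 5 * (rhoC r w x ^ 2 * thetaC r w x) := by ring

/-- `|Θ(𝒯[L,k,l]) v w| ≤ (32π/5) L² + 0 · (‖v‖² + ‖w‖²)` (the quadratic-growth form with zero growth; `0 < L`). [folklore] -/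
theorem abs_sphereMark_markT_le_const {L : ℝ} (hL : 0 < L) (k l : Fin 3) (v w : V3) :
    |sphereMark 𝒯[L, k, l] v w| ≤ 32 * Real.pi / 5 * L ^ 2 + 0 * (‖v‖ ^ 2 + ‖w‖ ^ 2) := by
  rw [zero_mul, add_zero]
  refine (abs_sphereMark_markT_le hL k l v w).trans ?_
  have hcc := cc_mem L v w
  by_cases h0 : speedCutoff L ‖v‖ * speedCutoff L ‖w‖ = 0
  · rw [h0, mul_zero]; positivity
  · have hvw : ‖w - v‖ ≤ 4 * L := by rw [norm_sub_rev]; exact norm_sub_le_of_cc_ne_zero hL h0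
    have h2 : ‖w - v‖ ^ 2 ≤ (4 * L) ^ 2 := pow_le_pow_left₀ (norm_nonneg _) hvw 2
    calc 2 * Real.pi / 5 * ‖w - v‖ ^ 2 * (speedCutoff L ‖v‖ * speedCutoff L ‖w‖)
        ≤ 2 * Real.pi / 5 * (4 * L) ^ 2 * 1 := by gcongr <;> [exact hcc.1; exact hcc.2]
      _ = 32 * Real.pi / 5 * L ^ 2 := by ring

/-- **Sup bound of the truncated-stress pair functional**: `|B_r(𝒯[L,k,l])| ≤ (3/(πr³))² (32π/5) L²`
(`0 < L`, `0 < r`; an `r`-dependent constant, used only for integrability). [folklore] -/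
theorem abs_pairFunctional_markT_le_const {L r : ℝ} (hL : 0 < L) (hr : 0 < r) (w : Phase N) (x : T3) (k l : Fin 3) :
    |pairFunctional r 𝒯[L, k, l] w x| ≤ (3 / (Real.pi * r ^ 3)) ^ 2 * (32 * Real.pi / 5 * L ^ 2) := by
  have h := abs_pairFunctional_le_of_sphereMark_le (abs_sphereMark_markT_le_const hL k l) hr w x
  simpa only [zero_mul, mul_zero, zero_div, add_zero] using h

/-! ## §4 The dominating pair functional -/

/-- `0 ≤ B_r(ℬ[L]) ≤ 16πL² ρ_r²` (`0 < L`, `0 < r`). [folklore] -/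
theorem pairFunctional_markB_mem {L r : ℝ} (hL : 0 < L) (hr : 0 < r) (w : Phase N) (x : T3) :
    0 ≤ pairFunctional r ℬ[L] w x ∧ pairFunctional r ℬ[L] w x ≤ 16 * Real.pi * L ^ 2 * rhoC r w x ^ 2 := by
  rw [pairFunctional_eq_double_sum]
  simp only [coneKernel_eq_cone]
  have hN : 0 ≤ ((N + 1 : ℕ) : ℝ)⁻¹ * ((N + 1 : ℕ) : ℝ)⁻¹ := by positivity
  have hterm : ∀ i j, 0 ≤ cone r (w i).1 x * cone r (w j).1 x * sphereMark ℬ[L] (w i).2 (w j).2 ∧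
      cone r (w i).1 x * cone r (w j).1 x * sphereMark ℬ[L] (w i).2 (w j).2 ≤
        16 * Real.pi * L ^ 2 * (cone r (w i).1 x * cone r (w j).1 x) := by
    intro i j
    have hS := sphereMark_markB_mem hL (w i).2 (w j).2
    have hbb : 0 ≤ cone r (w i).1 x * cone r (w j).1 x := mul_nonneg (cone_nonneg hr _ _) (cone_nonneg hr _ _)
    refine ⟨mul_nonneg hbb hS.1, ?_⟩
    have hcc := cc_mem L (w i).2 (w j).2
    calc cone r (w i).1 x * cone r (w j).1 x * sphereMark ℬ[L] (w i).2 (w j).2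
        ≤ cone r (w i).1 x * cone r (w j).1 x * (16 * Real.pi * L ^ 2 * 1) := by
          refine mul_le_mul_of_nonneg_left (hS.2.trans ?_) hbb
          gcongr; exact hcc.2
      _ = 16 * Real.pi * L ^ 2 * (cone r (w i).1 x * cone r (w j).1 x) := by ring
  refine ⟨mul_nonneg hN (Finset.sum_nonneg fun i _ => Finset.sum_nonneg fun j _ => (hterm i j).1), ?_⟩
  calc ((N + 1 : ℕ) : ℝ)⁻¹ * ((N + 1 : ℕ) : ℝ)⁻¹ *
        ∑ i, ∑ j, cone r (w i).1 x * cone r (w j).1 x * sphereMark ℬ[L] (w i).2 (w j).2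
      ≤ ((N + 1 : ℕ) : ℝ)⁻¹ * ((N + 1 : ℕ) : ℝ)⁻¹ *
          ∑ i, ∑ j, 16 * Real.pi * L ^ 2 * (cone r (w i).1 x * cone r (w j).1 x) :=
        mul_le_mul_of_nonneg_left (Finset.sum_le_sum fun i _ => Finset.sum_le_sum fun j _ => (hterm i j).2) hN
    _ = 16 * Real.pi * L ^ 2 * rhoC r w x ^ 2 := by
        rw [rhoC_eq_sum]
        simp only [← Finset.mul_sum, ← Finset.sum_mul]
        ring

/-! ## §5 The equation-of-state value identity -/

/-- **The value identity** `σ³ Y(σ³ρ_r) (4π/3) ρ_r²θ_r = 2 p_ex` with `Y = contactValue = (3/2π) f_ex′` and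
`p_ex = hsPressure σ ρ_r θ_r − ρ_rθ_r = ρ_rθ_r · ρ_rσ³ f_ex′(ρ_rσ³)`. [cite: VanbeijerenErnst1973] -/
theorem two_mul_pexC_eq (σ r : ℝ) (w : Phase N) (x : T3) :
    2 * pexC σ r w x =
      σ ^ 3 * (contactValue (σ ^ 3 * rhoC r w x) * (4 * Real.pi / 3 * (rhoC r w x ^ 2 * thetaC r w x))) := by
  unfold pexC hsPressure hsCompressibility contactValue
  rw [mul_comm (rhoC r w x) (σ ^ 3)]
  field_simp
  ring

/-! ## §6 Registered sub-goal -/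

/-- **Registered sub-goal `stub_pressureValueB` (helper B of `stub_pressureValueOfEnskog`): the equation-of-state
value identity** `2 p_ex = σ³ Y(σ³ρ_r) (4π/3) ρ_r²θ_r`. [folklore] -/
theorem stub_pressureValueB : ∀ {N : ℕ} (σ r : ℝ) (w : Config (N + 1) (Fin 3) T3) (x : T3), 2 * pexC σ r w x = σ ^ 3 * (contactValue (σ ^ 3 * rhoC r w x) * (4 * Real.pi / 3 * (rhoC r w x ^ 2 * thetaC r w x))) :=
  fun σ r w x => two_mul_pexC_eq σ r w x

end Summit.AtomisticToContinuum.HydrodynamicLimit.Theorems.ChaosClosesEulerPressureValue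

end
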